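import Literature.Geometry.Lorentzian.CoordShrinkerIdentities
import Literature.Geometry.Lorentzian.CoordSigma2Linearization
import HarnessLib

/-!
# `|∇S|² ≤ 4 |Ric|² |∇f|²` on a gradient Ricci soliton, in coordinates

One more pointwise consequence of Hamilton's identity `∇S = 2 Ric(∇f, ·)` for gradient Ricci
solitons (`IsMetricOn.fderiv_scalAt_of_soliton`, `CoordShrinkerIdentities.lean`), in the
coordinate tensor calculus of metric components `G : E → (E →L E →L ℝ)` on an open set `V`
(`MetricCoord.IsMetricOn G V`): at a point `x ∈ V` where `G x` is positive definite, for
components satisfying the soliton equation `Ric + Hess f = λ G` on `V`,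

  `|∇S|²_G (x) ≤ 4 |Ric|²_G (x) |∇f|²_G (x)`

(`gradSqAt`, `normSqAt` of `CoordCurvature.lean` / `CoordCurvatureLaplacian.lean`). This is the
Cauchy–Schwarz step `|∇S| = 2|Ric(∇f)| ≤ 2|Ric||∇f|` with which Munteanu–Wang control the
`|∇S|²`- and `⟨∇S^{-a}, ∇|Ric|²⟩`-terms of `Δ_f (|Ric|² S^{-a})` in the proof of their Lemma 1.2
(from the identities `∇_k R_{jk} = R_{jk} f_k = ½ ∇_j S` recalled in their §1). Proof: in a
`G x`-orthonormal basis `e` (`exists_orthonormal_basis`), `dS(e_c) = 2 Σ_a df(e_a) Ric(e_a, e_c)`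
(`sharpAt_eq_sum_frame`), `|∇S|² = Σ_c dS(e_c)²`, `|∇f|² = Σ_a df(e_a)²`
(`gradSqAt_eq_sum_frame`), `|Ric|² = Σ_{ac} Ric(e_a, e_c)²` (`normSqAt_eq_sum_frame`), and
`(Σ_a df(e_a) Ric(e_a, e_c))² ≤ (Σ_a df(e_a)²)(Σ_a Ric(e_a, e_c)²)` (`sq_sum_mul_le`) summed over `c`.

Everything is proved; no definition and no named fact is introduced.

## References

* O. Munteanu, J. Wang, *Geometry of shrinking Ricci solitons*, Compositio Math. 151 (2015)
  2273–2300 (arXiv:1410.3813), §1: the soliton identities `∇_k R_{jk} = R_{jk} f_k = ½ ∇_j S`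
  (p. 4) and the proof of Lemma 1.2 (p. 5). [MunteanuWang2015]
* R. S. Hamilton, *The formation of singularities in the Ricci flow*, Surveys in Differential
  Geometry 2 (1995) 7–136, §20 (`∇S = 2 Ric(∇f, ·)` for gradient solitons). [Hamilton1995]
-/

noncomputable section

set_option maxSynthPendingDepth 3

open Set Filter ContinuousLinearMap Module
open scoped Topology ContDiff

namespace Literature.Geometry.Lorentzian

namespace MetricCoord

variable {E : Type*} [NormedAddCommGroup E] [NormedSpace ℝ E] [FiniteDimensional ℝ E]
  [CompleteSpace E] {G : E → E →L[ℝ] E →L[ℝ] ℝ} {V : Set E} {x : E} {f : E → ℝ} {lam : ℝ}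

/-- **`|∇S|² ≤ 4 |Ric|² |∇f|²` on a gradient Ricci soliton** (chart level): for metric components
with `Ric + Hess f = λ G` on `V` and a point `x ∈ V` at which `G x` is positive definite,
`|∇S|²_G (x) ≤ 4 |Ric|²_G (x) · |∇f|²_G (x)`. By Hamilton's identity `dS = 2 Ric(♯df, ·)`
(`IsMetricOn.fderiv_scalAt_of_soliton`; Munteanu–Wang 2015, §1: `R_{jk} f_k = ½ ∇_j S`) and the
Cauchy–Schwarz inequality in a `G x`-orthonormal frame, as used for the gradient terms of
`Δ_f(|Ric|² S^{-a})` in the proof of Munteanu–Wang 2015, Lemma 1.2.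
[cite: MunteanuWang2015, Lemma 1.2 (proof)] [cite: Hamilton1995, §20] -/
theorem IsMetricOn.gradSqAt_scalAt_le_of_soliton (hG : IsMetricOn G V) (hx : x ∈ V)
    (hpos : ∀ v : E, v ≠ 0 → 0 < G x v v) (hf : ContDiffOn ℝ ∞ f V)
    (hsol : ∀ y ∈ V, ∀ v w, ricAt G y v w + hessAt G f y v w = lam * G y v w) :
    gradSqAt G (scalAt G) x ≤ 4 * normSqAt G x (ricAt G x) * gradSqAt G f x := by
  classical
  have hs := hG.symm x hx
  have hi := hG.isInvertible x hx
  obtain ⟨e, he⟩ := exists_orthonormal_basis hs hpos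
  -- frame components of `df` and of `Ric`
  set d : Fin (finrank ℝ E) → ℝ := fun a ↦ fderiv ℝ f x (e a)
  set R : Fin (finrank ℝ E) → Fin (finrank ℝ E) → ℝ := fun a c ↦ ricAt G x (e a) (e c)
  -- Hamilton's identity in the frame: `dS(e_c) = 2 Σ_a df(e_a) Ric(e_a, e_c)`
  have hdS : ∀ c, fderiv ℝ (scalAt G) x (e c) = 2 * ∑ a, d a * R a c := fun c ↦ by
    rw [hG.fderiv_scalAt_of_soliton hx hf hsol (e c), sharpAt_eq_sum_frame e he hi hs,
      map_sum, _root_.sum_apply]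
    congr 1
    exact Finset.sum_congr rfl fun a _ ↦ by rw [map_smul, _root_.smul_apply, smul_eq_mul]
  -- the three square norms in the frame
  have hS : gradSqAt G (scalAt G) x = ∑ c, (2 * ∑ a, d a * R a c) ^ 2 := by
    rw [gradSqAt_eq_sum_frame e he hi hs]
    exact Finset.sum_congr rfl fun c _ ↦ by rw [hdS]
  have hF : gradSqAt G f x = ∑ a, d a ^ 2 := gradSqAt_eq_sum_frame e he hi hs f
  have hN : normSqAt G x (ricAt G x) = ∑ a, ∑ c, R a c ^ 2 :=
    normSqAt_eq_sum_frame e he hi hs _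
  have hcomm : ∑ c, ∑ a, R a c ^ 2 = ∑ a, ∑ c, R a c ^ 2 := Finset.sum_comm
  -- Cauchy–Schwarz in the index `a`, for each `c`
  have hCS : ∀ c, (∑ a, d a * R a c) ^ 2 ≤ (∑ a, d a ^ 2) * ∑ a, R a c ^ 2 := fun c ↦
    sq_sum_mul_le d fun a ↦ R a c
  rw [hS, hF, hN]
  calc ∑ c, (2 * ∑ a, d a * R a c) ^ 2 = 4 * ∑ c, (∑ a, d a * R a c) ^ 2 := by
        rw [Finset.mul_sum]
        exact Finset.sum_congr rfl fun c _ ↦ by ring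
    _ ≤ 4 * ∑ c, (∑ a, d a ^ 2) * ∑ a, R a c ^ 2 :=
        mul_le_mul_of_nonneg_left (Finset.sum_le_sum fun c _ ↦ hCS c) (by norm_num)
    _ = 4 * (∑ a, ∑ c, R a c ^ 2) * ∑ a, d a ^ 2 := by
        rw [← Finset.mul_sum, hcomm]
        ring

end MetricCoord

end Literature.Geometry.Lorentzian

end
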